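import Mathlib
import Literature.NumberTheory.Irrationality.Brown2016.DinnerParties
import Literature.NumberTheory.Irrationality.BrownZudilin2022.CellularZetaFive
import Summits.KontsevichZagierPeriods.Zeta5Search.Families.CellularIntegral
import HarnessLib

/-!
# ζ(5) search — Families: the Brown–Zudilin configuration `₈π₈^∨` as an instance of the general cellular integral

HONEST FRAMING: systematic search; no irrationality claim unless certified.

Cell `pub-zeta5`, seat P2.  ANCHORS tying the configuration-generic definitions of `Families/CellularIntegral.lean`
(Brown 2016 §1.5/§5, simplicial coordinates, valuation calculus) to the typed Brown–Zudilin data of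
`Literature/…/BrownZudilin2022/CellularZetaFive.lean` [BrownZudilin2022, §1 (1)–(3)], for EVERY `a ∈ ℤ⁸`:

* `pi8dual = (8,2,4,1,7,5,3,6)` (0-based `![7,1,3,0,6,4,2,5]`) = `Brown2016.reps8[9]` read by `ofSeating`;
* `bzNum a`, `bzDen a` — the sixteen edge exponents of [Brown2016, (5.4)] in the Brown–Zudilin parametrisation (2): the
  eleven visible in (1) plus the five on omitted/constant factors (`a₇₈ = a₁+a₅−a₃`, `a₈₁ = a₇`, `b₁₇ = a₁+a₂+a₆−a₄−a₈`,
  `b₈₂ = a₁−a₃−a₆+a₇+a₈`, `b₆₈ = a₅+a₆−a₈`), which are FORCED by Brown's homogeneity equations (`homogeneous_bz`);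
* `integrand_bz` : `integrand pi8dual (bzNum a) (bzDen a) = BrownZudilin2022.integrand a` (as functions on `ℝ⁵`);
* `openSimplex_five`, `integral_bz` : `integral pi8dual (bzNum a) (bzDen a) = BrownZudilin2022.cellularIntegral a`;
* `brownConvergent_bz_iff` : Brown's chord-by-chord condition `BrownConvergent` (40 valuations) `↔ BrownZudilin2022.Converges a`
  (the seventeen forms (3)) — two published sources agree, kernel-checked; the 40 valuations are the 17 forms plus the implied
  `a₁+a₂+1`, `a₄+a₅+1`, `a₂+a₃+a₆−a₈+1` (second implementation: HOME `code/p2/cellular_forms.py`);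
* the totally symmetric ray: `bzNum_const`, `bzDen_const`, `integral_bz_symmetric` (= `cellularIntegral (fun _ => n)`, i.e.
  the integrals of [BrownZudilin2022, §2] / Zudilin 2002), `brownConvergent_pi8dual_basic_iff` (`↔ 0 ≤ N`).
-/

noncomputable section

open MeasureTheory Finset Set

namespace Summit.KontsevichZagierPeriods.Zeta5Search.Families.Cellular

open Literature.NumberTheory.Irrationality

/-! ### The Brown–Zudilin configuration `₈π₈^∨ = (8,2,4,1,7,5,3,6)` -/

/-- `₈π₈^∨ = (8,2,4,1,7,5,3,6)` [Brown2016, App. 2 §10.1.4; BrownZudilin2022, §1] as a map `Fin 8 → Fin 8`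
(0-based values `(7,1,3,0,6,4,2,5)`). -/
def pi8dual : Fin 8 → Fin 8 := ![7, 1, 3, 0, 6, 4, 2, 5]

/-- `pi8dual` is the printed seating plan no. 10 of `Brown2016.reps8` (`₈π₈^∨`), read 0-based. -/
theorem pi8dual_eq_ofSeating : pi8dual = ofSeating (ℓ := 5) [8, 2, 4, 1, 7, 5, 3, 6] ∧
    Brown2016.reps8[9]? = some [8, 2, 4, 1, 7, 5, 3, 6] := by
  refine ⟨?_, rfl⟩
  decide

/-- `pi8dual` is injective (a permutation). -/
theorem pi8dual_injective : Function.Injective pi8dual := by decide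

/-- Brown–Zudilin's parametrisation of the exponents [BrownZudilin2022, §1 eqs. (1)–(2)], numerator side (edges of `δ⁰`
by position): `a_{12},…,a_{67} = a₁,…,a₆`, and the two edges through `z₈ = ∞`: `a_{78} = a₁ + a₅ − a₃`, `a_{81} = a₇`
(forced by Brown's homogeneity equations, `homogeneous_bz`). Indices of `a : Fin 8 → ℤ` are `0,…,7` for `a₁,…,a₈`. -/
def bzNum (a : Fin 8 → ℤ) : Fin 8 → ℤ :=
  ![a 0, a 1, a 2, a 3, a 4, a 5, a 0 + a 4 - a 2, a 6]

/-- Brown–Zudilin's parametrisation, denominator side (edges of `σδ⁰` by position, `σ = (8,2,4,1,7,5,3,6)`):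
`b₈₂ = a₁−a₃−a₆+a₇+a₈`, `b₂₄`, `b₁₄` [(2)], `b₁₇ = a₁+a₂+a₆−a₄−a₈` (the factor `z₇ − z₁ = 1`), `b₅₇`, `b₃₅`, `b₃₆ = a₈` [(2)],
`b₆₈ = a₅+a₆−a₈`; the three exponents not printed in (1) sit on omitted factors and are forced by homogeneity. -/
def bzDen (a : Fin 8 → ℤ) : Fin 8 → ℤ :=
  ![a 0 - a 2 - a 5 + a 6 + a 7, BrownZudilin2022.b24 a, BrownZudilin2022.b14 a, a 0 + a 1 + a 5 - a 3 - a 7,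
    BrownZudilin2022.b57 a, BrownZudilin2022.b35 a, BrownZudilin2022.b36 a, a 4 + a 5 - a 7]

/-- The Brown–Zudilin exponents satisfy Brown's homogeneity equations for every `a ∈ ℤ⁸`. [Brown2016, (5.2); BrownZudilin2022, (2)] -/
theorem homogeneous_bz (a : Fin 8 → ℤ) : Homogeneous pi8dual (bzNum a) (bzDen a) := by
  intro i
  fin_cases i <;>
    simp [pi8dual, bzNum, bzDen, BrownZudilin2022.b24, BrownZudilin2022.b14, BrownZudilin2022.b57,
      BrownZudilin2022.b35, BrownZudilin2022.b36, Fin.sub_def] <;> ring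

/-- ANCHOR: for `σ = ₈π₈^∨` and the Brown–Zudilin exponents, the general simplicial-coordinate integrand of this file IS
the integrand (1) of [BrownZudilin2022] typed in `BrownZudilin2022.CellularZetaFive` — as functions on all of `ℝ⁵`. -/
theorem integrand_bz (a : Fin 8 → ℤ) (t : Fin 5 → ℝ) :
    integrand pi8dual (bzNum a) (bzDen a) t = BrownZudilin2022.integrand a t := by
  simp [integrand, num, den, formDen, Fin.prod_univ_eight, pi8dual, bzNum, bzDen, ef, pt, max_def, min_def,
    BrownZudilin2022.integrand]

/-- The simplex of this file for `ℓ = 5` is the simplex `0 < t₁ < ⋯ < t₅ < 1` of `BrownZudilin2022.CellularZetaFive`. -/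
theorem openSimplex_five : openSimplex 5 = BrownZudilin2022.openSimplex := by
  ext t
  simp [openSimplex, BrownZudilin2022.openSimplex, Fin.forall_fin_succ, pt]

/-- ANCHOR: the generalised cellular integral of `₈π₈^∨` with the Brown–Zudilin exponents is `I(a)` of
[BrownZudilin2022, (1)] (`BrownZudilin2022.cellularIntegral a`), for every `a ∈ ℤ⁸`. -/
theorem integral_bz (a : Fin 8 → ℤ) : integral pi8dual (bzNum a) (bzDen a) = BrownZudilin2022.cellularIntegral a := by
  unfold integral BrownZudilin2022.cellularIntegral
  rw [openSimplex_five]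
  congr 1
  ext t
  exact integrand_bz a t

/-- The seventeen linear forms (3) of [BrownZudilin2022] spelled out: `Converges a` as an explicit conjunction. -/
theorem converges_iff (a : Fin 8 → ℤ) : BrownZudilin2022.Converges a ↔
    (0 ≤ a 0 ∧ 0 ≤ a 1 ∧ 0 ≤ a 2 ∧ 0 ≤ a 3 ∧ 0 ≤ a 4 ∧ 0 ≤ a 5 ∧ 0 ≤ a 6 ∧ 0 ≤ a 0 + a 4 - a 2 ∧
      0 ≤ a 2 + a 5 - a 7 ∧ 0 ≤ a 3 + a 4 + a 6 + a 7 - a 1 - a 2 - a 5 ∧ 0 ≤ a 6 + a 7 - a 5 ∧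
      0 ≤ a 3 + a 7 - a 1 ∧ 0 ≤ a 1 + a 2 + a 5 - a 3 - a 7 ∧ 0 ≤ a 0 + a 7 - a 2 ∧ 0 ≤ a 0 + a 1 - a 3 ∧
      0 ≤ a 3 + a 4 - a 1 ∧ 0 ≤ a 3 + a 6 + 2 * a 7 - a 1 - a 2 - a 5) := by
  simp [BrownZudilin2022.Converges, BrownZudilin2022.convergenceForms]

/-- ANCHOR (two published sources agree, for all `a ∈ ℤ⁸`): Brown's divisor-by-divisor convergence condition for
`₈π₈^∨` with the Brown–Zudilin exponents — the `8 × 5 = 40` chords `S = {p,…,p+k−1}`, `2 ≤ k ≤ 6`, each divisor counted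
twice — is EQUIVALENT to the seventeen linear forms (3) of [BrownZudilin2022] ("from [Brown2016, §§5.1–5.2]"): the 40
valuations are BZ's 17 forms together with the three implied forms `a₁+a₂+1`, `a₄+a₅+1`, `a₂+a₃+a₆−a₈+1`
(second implementation: HOME `code/p2/cellular_forms.py`). [Brown2016, §2.4, §3.4, §5.2; BrownZudilin2022, (3)] -/
theorem brownConvergent_bz_iff (a : Fin 8 → ℤ) :
    BrownConvergent pi8dual (bzNum a) (bzDen a) ↔ BrownZudilin2022.Converges a := by
  rw [converges_iff]
  unfold BrownConvergent twoOrd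
  dsimp only [Nat.reduceAdd]
  simp only [forall_fin8, forall_fin5, Fin.sum_univ_eight]
  simp [sameSide, pi8dual, bzNum, bzDen, BrownZudilin2022.b24, BrownZudilin2022.b14, BrownZudilin2022.b57,
    BrownZudilin2022.b35, BrownZudilin2022.b36]
  constructor <;> intro h <;> and_intros <;> omega

/-! ### The totally symmetric ray `a = (n,…,n)` -/

/-- On the totally symmetric ray all sixteen numerator exponents are `n`. -/
theorem bzNum_const (n : ℤ) : bzNum (fun _ => n) = fun _ => n := by
  ext i; fin_cases i <;> simp [bzNum]

/-- On the totally symmetric ray all sixteen denominator exponents are `n`. -/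
theorem bzDen_const (n : ℤ) : bzDen (fun _ => n) = fun _ => n := by
  ext i
  fin_cases i <;> simp [bzDen, BrownZudilin2022.b24, BrownZudilin2022.b14, BrownZudilin2022.b57,
    BrownZudilin2022.b35, BrownZudilin2022.b36]

/-- The basic cellular integral `I_{₈π₈^∨}(n)` is the totally symmetric Brown–Zudilin integral `I(n,…,n)`
[BrownZudilin2022, §2] (Zudilin's 2002 integrals). -/
theorem integral_bz_symmetric (n : ℤ) :
    integral pi8dual (fun _ => n) (fun _ => n) = BrownZudilin2022.cellularIntegral (fun _ => n) := by
  have h := integral_bz (fun _ => n)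
  rwa [bzNum_const, bzDen_const] at h

/-- Brown's convergence condition for the basic cellular integrals of `₈π₈^∨` holds iff `N ≥ 0` (the 40 valuations are
`2N` (34 times) and `4N+2` (6 times)). [Brown2016, Lemma 3.6 / App. 2 §10.1.4 (₈π₈^∨ convergent)] -/
theorem brownConvergent_pi8dual_basic_iff (N : ℤ) : BrownConvergent pi8dual (fun _ => N) (fun _ => N) ↔ 0 ≤ N := by
  unfold BrownConvergent twoOrd
  dsimp only [Nat.reduceAdd]
  simp only [forall_fin8, forall_fin5, Fin.sum_univ_eight]
  simp [sameSide, pi8dual]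
  constructor <;> intro h <;> and_intros <;> omega

end Summit.KontsevichZagierPeriods.Zeta5Search.Families.Cellular
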